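import Summits.Ventures.PercRepro.Night2FatZAll

/-!
# night-2: the non-degenerate regime at the SOURCES — the weakest form of the fat-case theorem

`localShadowHall_fat_of_hnd` asks (HND) of every three-point class line of `H₀`; the proof uses it only at the line and
the coloops of a lossy big pair WITHOUT good points.  **`two_planes_of_no_gtPts_explicit`** restates the two-planes
data with the line `R = (Q ∖ K) ∖ coloops (Q ∖ K)` named, and **`localShadowHall_fat_of_nondeg_sources`** is the fat
case of (FAIR) under non-degeneracy at those sources only: for every lossy big pair `(B, z)` without good points and
every coloop `c` of `Q ∖ K` off the off-points, the points of `H₀` outside `clF (insert c R)` have rank `≥ 3`.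
Paper `proofs/NIGHT-2-g34.md` §6.
-/

namespace PercRepro.Shadow

open PercRepro.ThmH PercRepro.PerFlat

variable {α : Type*} [DecidableEq α] {M : Matroid α} [M.Finite] {G : Finset α}

/-- **The two-planes data with the line named explicitly**: for a lossy big pair `(B, z)` without good points and
`R = (Q ∖ K) ∖ coloops (Q ∖ K)`, the coloops `c₂ ≠ c₃` of `Q ∖ K` off the off-points satisfy `c₂ ∉ clF R`,
`c₃ ∉ clF (insert c₂ R)` and cover `H₀` by the two planes (`exists_two_planes_of_no_gtPts` without the existential). -/
theorem two_planes_of_no_gtPts_explicit (hG : G ∈ flatsQ M (5 + 1)) (hd : (gr M \ G).card = 2)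
    (hk : kColoops M G = 1) (hs : ∀ e ∈ gr M, ∀ f ∈ gr M, e ≠ f → rkN M {e, f} = 2)
    (hl : ∀ e ∈ gr M, M.Indep {e}) {B₀ : Finset α} (hB₀ : B₀ ∈ thinMembers M 5 G) {w₀ x : α}
    (hD : G \ clF M B₀ = {w₀, x}) {B : Finset α} (hB : B ∈ thinMembers M 5 G)
    (hbig : 5 ≤ (B \ coloops M G).card) {z : α} (hz : z ∈ G \ clF M B) (h : loss M 5 G B z ≠ 0)
    (hno : ¬ (gtPts M 5 G (insert z B)).Nonempty) :
    (insert z B \ coloops M G) \ coloops M (insert z B \ coloops M G) ⊆ (G \ coloops M G) \ {w₀, x} ∧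
    rkN M ((insert z B \ coloops M G) \ coloops M (insert z B \ coloops M G)) = 2 ∧
    3 ≤ ((insert z B \ coloops M G) \ coloops M (insert z B \ coloops M G)).card ∧
    ∃ c₂ ∈ coloops M (insert z B \ coloops M G), ∃ c₃ ∈ coloops M (insert z B \ coloops M G),
      c₂ ∉ ({w₀, x} : Finset α) ∧ c₃ ∉ ({w₀, x} : Finset α) ∧
      c₂ ∉ clF M ((insert z B \ coloops M G) \ coloops M (insert z B \ coloops M G)) ∧
      c₃ ∉ clF M (insert c₂ ((insert z B \ coloops M G) \ coloops M (insert z B \ coloops M G))) ∧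
      ∀ e ∈ (G \ coloops M G) \ {w₀, x},
        e ∈ clF M (insert c₂ ((insert z B \ coloops M G) \ coloops M (insert z B \ coloops M G))) ∨
        e ∈ clF M (insert c₃ ((insert z B \ coloops M G) \ coloops M (insert z B \ coloops M G))) := by
  obtain ⟨hR2, hRcard⟩ := rkN_sdiff_coloops_eq_two_of_loss_ne_zero hG hd hk hs hl hB hbig hz h
  obtain ⟨c₂, hc₂, c₃, hc₃, hne, hc₂off, hc₃off, hcover⟩ :=
    two_planes_of_no_gtPts hG hd hk hs hl hB₀ hD hB hbig hz h hno
  set R := (insert z B \ coloops M G) \ coloops M (insert z B \ coloops M G) with hRdef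
  have hGg : G ⊆ gr M := (mem_flatsQ.1 hG).1
  have hd' : (gr M \ G).card ≤ 5 := by omega
  have hQG : insert z B ⊆ G :=
    Finset.insert_subset (Finset.mem_sdiff.1 hz).1 (subset_G_of_mem_thinMembers hB)
  have hKB : coloops M G ⊆ B := coloops_subset_of_mem_thinMembers hG hd' hB
  have hKQ : coloops M G ⊆ insert z B := hKB.trans (Finset.subset_insert _ _)
  have hzB : z ∉ B := fun h' => (Finset.mem_sdiff.1 hz).2 (subset_clF_of_subset_gr
    ((subset_G_of_mem_thinMembers hB).trans hGg) h')
  have hzK : z ∉ coloops M G := fun h' => hzB (hKB h')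
  have hQ'6 : 6 ≤ (insert z B \ coloops M G).card := by
    have heq : insert z B \ coloops M G = insert z (B \ coloops M G) := by
      ext e
      simp only [Finset.mem_sdiff, Finset.mem_insert]
      constructor
      · rintro ⟨h' | h', h2⟩
        · exact Or.inl h'
        · exact Or.inr ⟨h', h2⟩
      · rintro (rfl | ⟨h', h2⟩)
        · exact ⟨Or.inl rfl, hzK⟩
        · exact ⟨Or.inr h', h2⟩
    rw [heq, Finset.card_insert_of_notMem (fun h' => hzB (Finset.mem_sdiff.1 h').1)]
    omega
  have hR3 : 3 ≤ R.card := by omega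
  have hRQ' : R ⊆ insert z B \ coloops M G := Finset.sdiff_subset
  have hRG : R ⊆ G := hRQ'.trans (Finset.sdiff_subset.trans hQG)
  have hoff := notMem_or_notMem_insert_of_loss_ne_zero hG hd hk hs hl hB₀ hD hB hbig hz h
  have hRoff : ∀ u v : α, ({w₀, x} : Finset α) = {u, v} → u ∉ insert z B → u ∉ R ∧ v ∉ R := by
    intro u v huv huQ
    have huR : u ∉ R := fun h' => huQ (Finset.mem_sdiff.1 (hRQ' h')).1
    exact ⟨huR, notMem_of_rkN_le_two_of_notMem hs hG hD hRG (by omega) hR3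
      (by rw [huv]; exact Finset.pair_comm _ _) huR⟩
  have hw₀x : w₀ ∉ R ∧ x ∉ R := by
    rcases hoff with h' | h'
    · exact hRoff w₀ x rfl h'
    · exact (hRoff x w₀ (Finset.pair_comm _ _) h').symm
  have hRV : R ⊆ (G \ coloops M G) \ {w₀, x} := by
    intro r hr
    rw [Finset.mem_sdiff, Finset.mem_insert, Finset.mem_singleton]
    refine ⟨Finset.sdiff_subset_sdiff hQG (Finset.Subset.refl _) (hRQ' hr), ?_⟩
    rintro (rfl | rfl)
    · exact hw₀x.1 hr
    · exact hw₀x.2 hr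
  have hcol : ∀ c ∈ coloops M (insert z B \ coloops M G), c ∉ clF M ((insert z B).erase c) :=
    fun c hc => coloop_notMem_clF_erase hG hk hQG hKQ hc
  have hRerase : ∀ c ∈ coloops M (insert z B \ coloops M G), R ⊆ (insert z B).erase c := by
    intro c hc r hr
    refine Finset.mem_erase.2 ⟨?_, (Finset.mem_sdiff.1 (hRQ' hr)).1⟩
    intro hrc
    rw [hrc] at hr
    rw [hRdef, Finset.mem_sdiff] at hr
    exact hr.2 hc
  have hc₂R : c₂ ∉ clF M R := fun h' => hcol c₂ hc₂ (clF_mono (hRerase c₂ hc₂) h')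
  have hc₃R : c₃ ∉ clF M (insert c₂ R) := by
    intro h'
    apply hcol c₃ hc₃
    refine clF_mono ?_ h'
    refine Finset.insert_subset ?_ (hRerase c₃ hc₃)
    exact Finset.mem_erase.2 ⟨hne, (Finset.mem_sdiff.1 (mem_coloops.1 hc₂).1).1⟩
  refine ⟨hRV, hR2, hR3, c₂, hc₂, c₃, hc₃, hc₂off, hc₃off, hc₂R, hc₃R, ?_⟩
  intro e he
  rw [Finset.mem_sdiff] at he
  exact hcover e he.1 he.2

/-- **The fat case of (FAIR) under non-degeneracy AT THE SOURCES**: for every lossy big pair `(B, z)` without good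
points, with `R = (Q ∖ K) ∖ coloops (Q ∖ K)` its line and `c` any coloop of `Q ∖ K` off the off-points, the points of
`H₀` outside the plane `clF (insert c R)` have rank `≥ 3` — exactly what `localShadowHall_fat_of_hnd` uses. -/
theorem localShadowHall_fat_of_nondeg_sources (hG : G ∈ flatsQ M (5 + 1)) (hd : (gr M \ G).card = 2)
    (hk : kColoops M G = 1) (hs : ∀ e ∈ gr M, ∀ f ∈ gr M, e ≠ f → rkN M {e, f} = 2)
    (hl : ∀ e ∈ gr M, M.Indep {e}) (hfat : (fatClosures M 5 G 2).card ≤ 1)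
    {B₀ : Finset α} (hB₀ : B₀ ∈ thinMembers M 5 G) (hm₀ : (G \ clF M B₀).card = 2)
    (hND : ∀ B ∈ thinMembers M 5 G, 5 ≤ (B \ coloops M G).card → ∀ z ∈ G \ clF M B, loss M 5 G B z ≠ 0 →
      ¬ (gtPts M 5 G (insert z B)).Nonempty →
      ∀ c ∈ coloops M (insert z B \ coloops M G), c ∉ G \ clF M B₀ →
      3 ≤ rkN M (((G \ coloops M G) \ (G \ clF M B₀)).filter
        (fun e => e ∉ clF M (insert c ((insert z B \ coloops M G) \ coloops M (insert z B \ coloops M G)))))) :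
    LocalShadowHall M 5 G := by
  by_cases hgood : ∀ B ∈ thinMembers M 5 G, 5 ≤ (B \ coloops M G).card → ∀ z ∈ G \ clF M B,
      loss M 5 G B z ≠ 0 → (gtPts M 5 G (insert z B)).Nonempty
  · exact localShadowHall_fat_of_good hG hd hk hs hl hfat hB₀ hm₀ hgood
  · obtain ⟨B, hB, hbig, z, hz, hloss, hno⟩ : ∃ B ∈ thinMembers M 5 G, 5 ≤ (B \ coloops M G).card ∧
        ∃ z ∈ G \ clF M B, loss M 5 G B z ≠ 0 ∧ ¬ (gtPts M 5 G (insert z B)).Nonempty := by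
      by_contra hcon
      apply hgood
      intro B hB hbig z hz hloss
      by_contra hno
      exact hcon ⟨B, hB, hbig, z, hz, hloss, hno⟩
    obtain ⟨w₀, x, hne, hD⟩ := Finset.card_eq_two.1 hm₀
    obtain ⟨hRV, hR2, hR3, c₂, hc₂, c₃, hc₃, hc₂off, hc₃off, hc₂R, hc₃R, hcover⟩ :=
      two_planes_of_no_gtPts_explicit hG hd hk hs hl hB₀ hD hB hbig hz hloss hno
    set R := (insert z B \ coloops M G) \ coloops M (insert z B \ coloops M G) with hRdef
    have hGg : G ⊆ gr M := (mem_flatsQ.1 hG).1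
    have hd' : (gr M \ G).card ≤ 5 := by omega
    have hQG : insert z B ⊆ G :=
      Finset.insert_subset (Finset.mem_sdiff.1 hz).1 (subset_G_of_mem_thinMembers hB)
    have hcV : ∀ c ∈ coloops M (insert z B \ coloops M G), c ∉ ({w₀, x} : Finset α) →
        c ∈ (G \ coloops M G) \ {w₀, x} := fun c hc hcoff =>
      Finset.mem_sdiff.2 ⟨Finset.sdiff_subset_sdiff hQG (Finset.Subset.refl _) (mem_coloops.1 hc).1, hcoff⟩
    have hc₂V := hcV c₂ hc₂ hc₂off
    have hc₃V := hcV c₃ hc₃ hc₃off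
    have hVg : (G \ coloops M G) \ {w₀, x} ⊆ gr M := fun e he =>
      hGg (Finset.mem_sdiff.1 (Finset.mem_sdiff.1 he).1).1
    have hRg : R ⊆ gr M := hRV.trans hVg
    have hc₂g : c₂ ∈ gr M := hVg hc₂V
    have hc₃g : c₃ ∈ gr M := hVg hc₃V
    have hc₃L : c₃ ∉ clF M R := fun h' => hc₃R (clF_mono (Finset.subset_insert _ _) h')
    have hc₂π₃ : c₂ ∉ clF M (insert c₃ R) := notMem_clF_insert_of_notMem_clF_insert hRg hc₂g hc₃g hc₂R hc₃R
    rw [hD] at hND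
    have hfilter : ∀ u v : α, u ∈ gr M → v ∈ gr M → u ∉ clF M R → v ∉ clF M (insert u R) →
        (∀ e ∈ (G \ coloops M G) \ {w₀, x}, e ∈ clF M (insert u R) ∨ e ∈ clF M (insert v R)) →
        ((G \ coloops M G) \ {w₀, x}).filter (fun e => e ∉ clF M (insert u R)) =
          ((G \ coloops M G) \ {w₀, x}).filter (fun e => e ∈ clF M (insert v R) ∧ e ∉ clF M R) := by
      intro u v hug hvg hu hv hcov
      ext e
      simp only [Finset.mem_filter]
      constructor
      · rintro ⟨heV, heu⟩
        refine ⟨heV, ?_, fun heL => heu (clF_mono (Finset.subset_insert _ _) heL)⟩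
        rcases hcov e heV with h | h
        · exact absurd h heu
        · exact h
      · rintro ⟨heV, hev, heL⟩
        exact ⟨heV, fun heu => heL (mem_clF_of_mem_two_planes hRg hug hvg hu hv heu hev)⟩
    have hnd₃ : 3 ≤ rkN M (((G \ coloops M G) \ {w₀, x}).filter
        (fun e => e ∈ clF M (insert c₃ R) ∧ e ∉ clF M R)) := by
      rw [← hfilter c₂ c₃ hc₂g hc₃g hc₂R hc₃R hcover]
      exact hND B hB hbig z hz hloss hno c₂ hc₂ hc₂off
    have hnd₂ : 3 ≤ rkN M (((G \ coloops M G) \ {w₀, x}).filter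
        (fun e => e ∈ clF M (insert c₂ R) ∧ e ∉ clF M R)) := by
      rw [← hfilter c₃ c₂ hc₃g hc₂g hc₃L hc₂π₃ (fun e he => (hcover e he).symm)]
      exact hND B hB hbig z hz hloss hno c₃ hc₃ hc₃off
    exact localShadowHall_fat_of_two_planes_nondeg hG hd hk hs hl hfat hB₀ hD hne hRV hR2 hR3 hc₂V hc₃V hc₂R hc₃R
      hcover hnd₂ hnd₃

end PercRepro.Shadow
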